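import Summits.QuantumFields.YangMills.Theorems.BalabanUVNodesC44IterMhFramedAtRecordParam
import Summits.QuantumFields.YangMills.Theorems.BalabanUVNodesC44IterMhRegularPr
import HarnessLib

/-!
# (ℓa-C)ᵖʳ FROM PRINT'S (14), PARAMETRIC IN THE FRAME CONSTANT — F6ᵖʳ RE-PRESSED (`…_param`: `c𝔥` a binder, `C₂(c𝔥) = (6.4·10¹²·c𝔥 + 2.56·10¹⁶)·L·N`), AND THE RECORD
# INSTANCES AT `hierFrameDatumOfRecord` WITH EVERY FRAME HYPOTHESIS DISCHARGED ((T1)∕(T2) FROM (14): `hierFrameDatumOfRecord_hdom_of_regular` ∕ `_hnear_of_regular`)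

Cell `pub-ymgap` ∕ `ym-nodeO-ideate`, porter lineage `ymgap-nodeO-port-PTB-1` (gen 10); director-ym g24 №630 (2)(iii) (parametric re-press, commissioned; deprecate-and-add, new decl
names; the `≤ 1000` editions of ✓`…C44IterMhRegularPr` stay as the special case they are).  `--kind proof --supports stmt-QuantumFields-27238 --as helper`; count-neutral; NEW basename;
nothing appended, nothing re-declared.  [B7] = [Balaban1985Averaging]; [B11] = [Balaban1985Variational]; [I] = [Balaban1987RG1].

WHAT IS PROVED (0 def, 0 sorry, axioms standard; ns `Summit.QuantumFields.YangMills.Theorems.C44IterMh`):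
* §1 (generic datum, `c𝔥 ∈ [0, 10¹⁰]` a binder) ★★★ `prop4LetterCPrAtRecord_of_regular_param`, ★ `prop4UniformPrAtRecord_of_letters_loopProfile_param`,
  ★ `prop4UniformPrAtRecord_of_letters_regular_param` — F6ᵖʳ's three doors with `prop4LetterCPrAtRecord_of_loopProfile_param` in place of F5ᵖʳ; two-line glue each.
* §2 (the record's own datum, NO frame hypothesis) ★★ `hierFrameDatumOfRecord_hdom_of_regular` ∕ ★★ `hierFrameDatumOfRecord_hnear_of_regular` ((T1)∕(T2) from print's (14):
  ✓`loopProfile_of_regular` ⊗ ✓`hierFrameDatumOfRecord_hdom`∕`_hnear`, c𝔥 = 40000), ★★★ `prop4LetterCPrAtRecord_hierFrame_of_regular` ((ℓa-C)ᵖʳ at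
  `(2.816·10¹⁷·L·N, (2·10¹¹·L·N)⁻¹)` from (14) + `∀ x, x ∈ Ω_k` ALONE), ★ `prop4UniformPrAtRecord_hierFrame_of_letters_regular` (the G-door with that slot filled; the other letters
  DISPLAYED at the record's datum).

HONEST FRAMING.  Glue over landed theorems; (ℓa-C)ᵖʳ only in the small-field approximation (`Ω_k = T`); (ℓa-H)ᵖʳ, (ℓd)ᵖʳ, (ℓa-num), (ℓb), (ℓc) letters DISPLAYED; constants crude;
K0ᴬ ⟨stmt-QuantumFields-27238⟩ NOT closed; NODE O 0∕1; COUNT 8∕28 · K 1∕4 UNMOVED; finite `𝕋⁴_{L^K}` at fixed ε — NOT continuum ∕ ℝ⁴ ∕ OS ∕ Clay; **the Yang–Mills mass gap (Clay)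
is NOT proved by any of this.**  No `sorry`, `instance`, `notation`, `set_option`; standard axioms.
-/

noncomputable section

open scoped Matrix Matrix.Norms.L2Operator InnerProductSpace ComplexConjugate Topology

namespace Summit.QuantumFields.YangMills.Theorems.C44IterMh

open Literature.MathematicalPhysics.QuantumFieldTheory.Balaban1983to89
open Literature.MathematicalPhysics.QuantumFieldTheory.Balaban1983to89.Node00
open T4Continuum BlockAveraging
open B15AveragingHolomorphic (loopMh iterMh coeField_iter_eq_iterMh)
open B11Eq115Space (NegSup NegSize levWeight)
open B11Eq103H1Complex (SiteL2K)
open ExpMeanLog (expMeanLogSU deltaSU)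
open Filter
open Summit.QuantumFields.YangMills.Theorems.Prop4UniformAtRecord (prop4UniformPrAtRecord_of_letters_of_norm_J_le)

section Record

variable (F : T4Family) (N : ℕ) [NeZero N] {K : ℕ} (k : ℕ) (Ω : ℕ → Set (Site (F.P K) 0)) (U₀ : GaugeField (F.P K) 0 (SU N))

/-! ## §1  Generic datum, the window constant a binder -/

/-- ★★★ **THE FRAMED (ℓa-C) LETTER FROM (14), PARAMETRIC IN `c𝔥`**: `Prop4LetterCPrAtRecord … 𝔥 levB ((6.4·10¹²·c𝔥 + 2.56·10¹⁶)·L·N) ((2·10¹¹·L·N)⁻¹)` for every datum `𝔥`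
carrying (hdom)∕(hnear) with window constant `c𝔥 ∈ [0, 10¹⁰]`, under print's (14) at all scales `j < k` and `∀ x, x ∈ Ω_k` (✓`loopProfile_of_regular` ⊗
✓`prop4LetterCPrAtRecord_of_loopProfile_param`). [cite: Balaban1985Variational, (14) p.280, (44) p.285, Prop. 4 (97)–(98) pp.292–293; Balaban1985Averaging, (92) p.31, Proposition 3 p.36; Balaban1987RG1, (0.8) p.253] -/
theorem prop4LetterCPrAtRecord_of_regular_param [Fact (0 < (F.L : ℝ))] [Fact (0 < (F.P K).eta k)] [Fact (0 < c0Rec F K k)] [Fact (∀ c, 0 < wBRec F K k c)]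
    (𝔥 : FrameDatum (F.P K) N k U₀) (levB : PBond (F.P K) k → ℕ) (hΩ : ∀ x, x ∈ Ω k) {α : ℝ} (hα0 : 0 ≤ α) (hα : α * (11000000 * N) ≤ 1)
    (hreg : ∀ j, j < k → PlaqSmall (α * ((F.L : ℝ) ^ j * (F.P K).eta k) ^ 2) (Averaging.iter (avOfRecord F N K) j U₀))
    {c𝔥 : ℝ} (hc0 : 0 ≤ c𝔥) (hc : c𝔥 ≤ 10000000000)
    (hdom : ∀ Y : PBond (F.P K) 0 → Matrix (Fin N) (Fin N) ℂ, (∀ b, (Y b).trace = 0) → (F.L : ℝ) ^ k * ‖Y‖ < 1 / (25000000000 * (F.L : ℝ) * N) →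
      expOver U₀ Y ∈ 𝔥.dom)
    (hnear : ∀ Y : PBond (F.P K) 0 → Matrix (Fin N) (Fin N) ℂ, (∀ b, (Y b).trace = 0) → (F.L : ℝ) ^ k * ‖Y‖ < 1 / (25000000000 * (F.L : ℝ) * N) →
      ∀ y : Site (F.P K) k, ‖𝔥.map (expOver U₀ Y) y - 1‖ ≤ c𝔥 * ((F.L : ℝ) ^ k * ‖Y‖) ∧ ‖𝔥.inv (expOver U₀ Y) y - 1‖ ≤ c𝔥 * ((F.L : ℝ) ^ k * ‖Y‖)) :
    Prop4LetterCPrAtRecord F N K k Ω U₀ 𝔥 levB ((6400000000000 * c𝔥 + 25600000000000000) * (F.L : ℝ) * N) (1 / (200000000000 * (F.L : ℝ) * N)) := by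
  obtain ⟨hU₀, hε0, hε, hε50, hNε, hεsum⟩ := loopProfile_of_regular F N k U₀ hα0 hα hreg
  exact prop4LetterCPrAtRecord_of_loopProfile_param F N k Ω U₀ 𝔥 levB hU₀ hΩ _ hε0 hε hε50 hNε hεsum hc0 hc hdom hnear

/-- ★ **THE FRAMED PROP. 4 AT THE RECORD WITH THE (ℓa-C)ᵖʳ SLOT FILLED, LOOP-PROFILE EDITION, PARAMETRIC IN `c𝔥`** (the G-door ✓`prop4UniformPrAtRecord_of_letters_of_norm_J_le`
with `hC := prop4LetterCPrAtRecord_of_loopProfile_param`; the remaining letters stay HYPOTHESES at `C₂(c𝔥)`). Glue; no new estimate.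
[cite: Balaban1985Variational, Prop. 4 (97)–(98) pp.292–293, (44) p.285] -/
theorem prop4UniformPrAtRecord_of_letters_loopProfile_param [Fact (0 < (F.L : ℝ))] [Fact (0 < (F.P K).eta k)] [Fact (0 < c0Rec F K k)] [Fact (∀ c, 0 < wBRec F K k c)]
    (𝔥 : FrameDatum (F.P K) N k U₀) (levB : PBond (F.P K) k → ℕ) (a : ℝ)
    (hpos : ∀ x, x ≠ 0 → 0 < RCLike.re ⟪x, laplaceAOfRecord F N k U₀ (QprOfRecord F N k U₀ 𝔥) (QprimeOfRecord F N k U₀) a x⟫_ℂ)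
    (hQ : Function.Surjective (QprOfRecord F N k U₀ 𝔥)) {εC : ℝ}
    (Gp : SiteL2K ℂ (F.P K).d (fun _ => (F.P K).sitesPerDir 0) (c0Rec F K k) (WRec N) →ₗ[ℂ]
      SiteL2K ℂ (F.P K).d (fun _ => (F.P K).sitesPerDir 0) (c0Rec F K k) (WRec N))
    {b aC CV RV R' θ₃ θE θE' N₁ nJ : ℝ}
    (hU₀ : SmallBelow (avOfRecord F N K) k U₀) (hΩ : ∀ x, x ∈ Ω k) (εs : ℕ → ℝ) (hε0 : ∀ j, 0 ≤ εs j)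
    (hε : ∀ j, j < k → ∀ (c : PBond (F.P K) (j + 1)) (i : Idx (F.P K)), ‖loopM (coeField (Averaging.iter (avOfRecord F N K) j U₀)) c i - 1‖ ≤ εs j)
    (hε50 : ∀ j, j < k → εs j ≤ 1 / 50) (hNε : ∀ j, j < k → (N : ℝ) * εs j ≤ 2) (hεsum : 300000 * (Finset.range k).sum εs ≤ 1 / 4)
    {c𝔥 : ℝ} (hc0 : 0 ≤ c𝔥) (hc : c𝔥 ≤ 10000000000)
    (hdom : ∀ Y : PBond (F.P K) 0 → Matrix (Fin N) (Fin N) ℂ, (∀ b, (Y b).trace = 0) → (F.L : ℝ) ^ k * ‖Y‖ < 1 / (25000000000 * (F.L : ℝ) * N) →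
      expOver U₀ Y ∈ 𝔥.dom)
    (hnear : ∀ Y : PBond (F.P K) 0 → Matrix (Fin N) (Fin N) ℂ, (∀ b, (Y b).trace = 0) → (F.L : ℝ) ^ k * ‖Y‖ < 1 / (25000000000 * (F.L : ℝ) * N) →
      ∀ y : Site (F.P K) k, ‖𝔥.map (expOver U₀ Y) y - 1‖ ≤ c𝔥 * ((F.L : ℝ) ^ k * ‖Y‖) ∧ ‖𝔥.inv (expOver U₀ Y) y - 1‖ ≤ c𝔥 * ((F.L : ℝ) ^ k * ‖Y‖))
    (hH : Prop4LetterHPrAtRecord F N K k Ω U₀ 𝔥 levB a hpos hQ b)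
    (hnum : Prop4LetterNum b ((6400000000000 * c𝔥 + 25600000000000000) * (F.L : ℝ) * N) (1 / (200000000000 * (F.L : ℝ) * N)) aC εC RV R')
    (hV : Prop4LetterV0AtRecord F N K k Ω U₀ CV RV) (hsym : Prop4LetterSymmPrAtRecord F N K k Ω U₀ Gp)
    (hcol : Prop4LetterColumnsPrAtRecord F N K k Ω U₀ 𝔥 levB a hpos hQ εC Gp R' θ₃ θE θE' N₁) (hJ : ‖JOfRecordAtBg F N K k Ω U₀‖ ≤ nJ) :
    Prop4UniformPrAtRecord F N K k Ω U₀ 𝔥 levB a hpos hQ εC Gp (c4OfRecord N nJ b ((6400000000000 * c𝔥 + 25600000000000000) * (F.L : ℝ) * N) εC aC CV R' θ₃ θE θE' N₁) R' :=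
  prop4UniformPrAtRecord_of_letters_of_norm_J_le F N K k Ω U₀ 𝔥 levB a hpos hQ Gp hH
    (prop4LetterCPrAtRecord_of_loopProfile_param F N k Ω U₀ 𝔥 levB hU₀ hΩ εs hε0 hε hε50 hNε hεsum hc0 hc hdom hnear) hnum hV hsym hcol hJ

/-- ★ **THE FRAMED PROP. 4 AT THE RECORD WITH THE (ℓa-C)ᵖʳ SLOT FILLED FROM (14), PARAMETRIC IN `c𝔥`** (the G-door with `hC := prop4LetterCPrAtRecord_of_regular_param`).
Glue; no new estimate. [cite: Balaban1985Variational, (14) p.280, Prop. 4 (97)–(98) pp.292–293] -/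
theorem prop4UniformPrAtRecord_of_letters_regular_param [Fact (0 < (F.L : ℝ))] [Fact (0 < (F.P K).eta k)] [Fact (0 < c0Rec F K k)] [Fact (∀ c, 0 < wBRec F K k c)]
    (𝔥 : FrameDatum (F.P K) N k U₀) (levB : PBond (F.P K) k → ℕ) (a : ℝ)
    (hpos : ∀ x, x ≠ 0 → 0 < RCLike.re ⟪x, laplaceAOfRecord F N k U₀ (QprOfRecord F N k U₀ 𝔥) (QprimeOfRecord F N k U₀) a x⟫_ℂ)
    (hQ : Function.Surjective (QprOfRecord F N k U₀ 𝔥)) {εC : ℝ}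
    (Gp : SiteL2K ℂ (F.P K).d (fun _ => (F.P K).sitesPerDir 0) (c0Rec F K k) (WRec N) →ₗ[ℂ]
      SiteL2K ℂ (F.P K).d (fun _ => (F.P K).sitesPerDir 0) (c0Rec F K k) (WRec N))
    {b aC CV RV R' θ₃ θE θE' N₁ nJ : ℝ}
    (hΩ : ∀ x, x ∈ Ω k) {α : ℝ} (hα0 : 0 ≤ α) (hα : α * (11000000 * N) ≤ 1)
    (hreg : ∀ j, j < k → PlaqSmall (α * ((F.L : ℝ) ^ j * (F.P K).eta k) ^ 2) (Averaging.iter (avOfRecord F N K) j U₀))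
    {c𝔥 : ℝ} (hc0 : 0 ≤ c𝔥) (hc : c𝔥 ≤ 10000000000)
    (hdom : ∀ Y : PBond (F.P K) 0 → Matrix (Fin N) (Fin N) ℂ, (∀ b, (Y b).trace = 0) → (F.L : ℝ) ^ k * ‖Y‖ < 1 / (25000000000 * (F.L : ℝ) * N) →
      expOver U₀ Y ∈ 𝔥.dom)
    (hnear : ∀ Y : PBond (F.P K) 0 → Matrix (Fin N) (Fin N) ℂ, (∀ b, (Y b).trace = 0) → (F.L : ℝ) ^ k * ‖Y‖ < 1 / (25000000000 * (F.L : ℝ) * N) →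
      ∀ y : Site (F.P K) k, ‖𝔥.map (expOver U₀ Y) y - 1‖ ≤ c𝔥 * ((F.L : ℝ) ^ k * ‖Y‖) ∧ ‖𝔥.inv (expOver U₀ Y) y - 1‖ ≤ c𝔥 * ((F.L : ℝ) ^ k * ‖Y‖))
    (hH : Prop4LetterHPrAtRecord F N K k Ω U₀ 𝔥 levB a hpos hQ b)
    (hnum : Prop4LetterNum b ((6400000000000 * c𝔥 + 25600000000000000) * (F.L : ℝ) * N) (1 / (200000000000 * (F.L : ℝ) * N)) aC εC RV R')
    (hV : Prop4LetterV0AtRecord F N K k Ω U₀ CV RV) (hsym : Prop4LetterSymmPrAtRecord F N K k Ω U₀ Gp)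
    (hcol : Prop4LetterColumnsPrAtRecord F N K k Ω U₀ 𝔥 levB a hpos hQ εC Gp R' θ₃ θE θE' N₁) (hJ : ‖JOfRecordAtBg F N K k Ω U₀‖ ≤ nJ) :
    Prop4UniformPrAtRecord F N K k Ω U₀ 𝔥 levB a hpos hQ εC Gp (c4OfRecord N nJ b ((6400000000000 * c𝔥 + 25600000000000000) * (F.L : ℝ) * N) εC aC CV R' θ₃ θE θE' N₁) R' :=
  prop4UniformPrAtRecord_of_letters_of_norm_J_le F N K k Ω U₀ 𝔥 levB a hpos hQ Gp hH
    (prop4LetterCPrAtRecord_of_regular_param F N k Ω U₀ 𝔥 levB hΩ hα0 hα hreg hc0 hc hdom hnear) hnum hV hsym hcol hJ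

/-! ## §2  The record's own datum: every frame hypothesis discharged -/

/-- ★★ **(T1) FROM PRINT'S (14)**: under the regularity profile at all scales `j < k` (`α·1.1·10⁷·N ≤ 1`), every traceless `Y` on the scaled polydisc `L^k‖Y‖ < (2.5·10¹⁰·L·N)⁻¹`
has `e^{iY}U₀` in the window of the record's hierarchical frame datum (✓`loopProfile_of_regular` ⊗ ✓`hierFrameDatumOfRecord_hdom`).
[cite: Balaban1985Variational, (14) p.280; Balaban1985Averaging, (81) p.30, (85) p.30] -/
theorem hierFrameDatumOfRecord_hdom_of_regular [Fact (0 < (F.L : ℝ))] [Fact (0 < (F.P K).eta k)] {α : ℝ} (hα0 : 0 ≤ α) (hα : α * (11000000 * N) ≤ 1)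
    (hreg : ∀ j, j < k → PlaqSmall (α * ((F.L : ℝ) ^ j * (F.P K).eta k) ^ 2) (Averaging.iter (avOfRecord F N K) j U₀)) :
    ∀ Y : PBond (F.P K) 0 → Matrix (Fin N) (Fin N) ℂ, (∀ b, (Y b).trace = 0) → (F.L : ℝ) ^ k * ‖Y‖ < 1 / (25000000000 * (F.L : ℝ) * N) →
      expOver U₀ Y ∈ (hierFrameDatumOfRecord F N k U₀).dom := by
  obtain ⟨hU₀, hε0, hε, hε50, hNε, hεsum⟩ := loopProfile_of_regular F N k U₀ hα0 hα hreg
  exact hierFrameDatumOfRecord_hdom F N k U₀ hU₀ _ hε0 hε hε50 hNε hεsum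

/-- ★★ **(T2) FROM PRINT'S (14), `c𝔥 = 40000`**: under the same regularity profile, `‖𝔥.map(e^{iY}U₀)(y) − 1‖, ‖𝔥.inv(e^{iY}U₀)(y) − 1‖ ≤ 40000·L^k‖Y‖` at
`𝔥 := hierFrameDatumOfRecord F N k U₀` for every traceless `Y` on the scaled polydisc (✓`loopProfile_of_regular` ⊗ ✓`hierFrameDatumOfRecord_hnear`).
[cite: Balaban1985Variational, (14) p.280; Balaban1985Averaging, (89) p.31, (84)–(87) pp.30–31] -/
theorem hierFrameDatumOfRecord_hnear_of_regular [Fact (0 < (F.L : ℝ))] [Fact (0 < (F.P K).eta k)] {α : ℝ} (hα0 : 0 ≤ α) (hα : α * (11000000 * N) ≤ 1)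
    (hreg : ∀ j, j < k → PlaqSmall (α * ((F.L : ℝ) ^ j * (F.P K).eta k) ^ 2) (Averaging.iter (avOfRecord F N K) j U₀)) :
    ∀ Y : PBond (F.P K) 0 → Matrix (Fin N) (Fin N) ℂ, (∀ b, (Y b).trace = 0) → (F.L : ℝ) ^ k * ‖Y‖ < 1 / (25000000000 * (F.L : ℝ) * N) →
      ∀ y : Site (F.P K) k, ‖(hierFrameDatumOfRecord F N k U₀).map (expOver U₀ Y) y - 1‖ ≤ 40000 * ((F.L : ℝ) ^ k * ‖Y‖) ∧
        ‖(hierFrameDatumOfRecord F N k U₀).inv (expOver U₀ Y) y - 1‖ ≤ 40000 * ((F.L : ℝ) ^ k * ‖Y‖) := by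
  obtain ⟨hU₀, hε0, hε, hε50, hNε, hεsum⟩ := loopProfile_of_regular F N k U₀ hα0 hα hreg
  exact hierFrameDatumOfRecord_hnear F N k U₀ hU₀ _ hε0 hε hε50 hNε hεsum

/-- ★★★ **THE FRAMED (ℓa-C) LETTER AT THE RECORD'S OWN DATUM FROM (14), NO FRAME HYPOTHESIS**: `Prop4LetterCPrAtRecord … (hierFrameDatumOfRecord F N k U₀) levB (2.816·10¹⁷·L·N)
((2·10¹¹·L·N)⁻¹)` from print's (14) at all scales `j < k` and `∀ x, x ∈ Ω_k` ALONE (✓`loopProfile_of_regular` ⊗ ✓`prop4LetterCPrAtRecord_hierFrame_of_loopProfile`).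
[cite: Balaban1985Variational, (14) p.280, (44) p.285, Prop. 4 (97)–(98) pp.292–293; Balaban1985Averaging, (81) p.30, (89) p.31, (92) p.31; Balaban1987RG1, (0.8) p.253] -/
theorem prop4LetterCPrAtRecord_hierFrame_of_regular [Fact (0 < (F.L : ℝ))] [Fact (0 < (F.P K).eta k)] [Fact (0 < c0Rec F K k)] [Fact (∀ c, 0 < wBRec F K k c)]
    (levB : PBond (F.P K) k → ℕ) (hΩ : ∀ x, x ∈ Ω k) {α : ℝ} (hα0 : 0 ≤ α) (hα : α * (11000000 * N) ≤ 1)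
    (hreg : ∀ j, j < k → PlaqSmall (α * ((F.L : ℝ) ^ j * (F.P K).eta k) ^ 2) (Averaging.iter (avOfRecord F N K) j U₀)) :
    Prop4LetterCPrAtRecord F N K k Ω U₀ (hierFrameDatumOfRecord F N k U₀) levB (281600000000000000 * (F.L : ℝ) * N) (1 / (200000000000 * (F.L : ℝ) * N)) := by
  obtain ⟨hU₀, hε0, hε, hε50, hNε, hεsum⟩ := loopProfile_of_regular F N k U₀ hα0 hα hreg
  exact prop4LetterCPrAtRecord_hierFrame_of_loopProfile F N k Ω U₀ levB hU₀ hΩ _ hε0 hε hε50 hNε hεsum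

/-- ★ **THE FRAMED PROP. 4 AT THE RECORD'S OWN DATUM WITH THE (ℓa-C)ᵖʳ SLOT FILLED FROM (14)** — the G-door ✓`prop4UniformPrAtRecord_of_letters_of_norm_J_le` at
`𝔥 := hierFrameDatumOfRecord F N k U₀` with `hC := prop4LetterCPrAtRecord_hierFrame_of_regular` (`C₂ = 2.816·10¹⁷·L·N`); the other letters stay HYPOTHESES at that datum; NO
frame hypothesis. Glue; no new estimate. [cite: Balaban1985Variational, (14) p.280, Prop. 4 (97)–(98) pp.292–293] -/
theorem prop4UniformPrAtRecord_hierFrame_of_letters_regular [Fact (0 < (F.L : ℝ))] [Fact (0 < (F.P K).eta k)] [Fact (0 < c0Rec F K k)] [Fact (∀ c, 0 < wBRec F K k c)]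
    (levB : PBond (F.P K) k → ℕ) (a : ℝ)
    (hpos : ∀ x, x ≠ 0 → 0 < RCLike.re ⟪x, laplaceAOfRecord F N k U₀ (QprOfRecord F N k U₀ (hierFrameDatumOfRecord F N k U₀)) (QprimeOfRecord F N k U₀) a x⟫_ℂ)
    (hQ : Function.Surjective (QprOfRecord F N k U₀ (hierFrameDatumOfRecord F N k U₀))) {εC : ℝ}
    (Gp : SiteL2K ℂ (F.P K).d (fun _ => (F.P K).sitesPerDir 0) (c0Rec F K k) (WRec N) →ₗ[ℂ]
      SiteL2K ℂ (F.P K).d (fun _ => (F.P K).sitesPerDir 0) (c0Rec F K k) (WRec N))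
    {b aC CV RV R' θ₃ θE θE' N₁ nJ : ℝ}
    (hΩ : ∀ x, x ∈ Ω k) {α : ℝ} (hα0 : 0 ≤ α) (hα : α * (11000000 * N) ≤ 1)
    (hreg : ∀ j, j < k → PlaqSmall (α * ((F.L : ℝ) ^ j * (F.P K).eta k) ^ 2) (Averaging.iter (avOfRecord F N K) j U₀))
    (hH : Prop4LetterHPrAtRecord F N K k Ω U₀ (hierFrameDatumOfRecord F N k U₀) levB a hpos hQ b)
    (hnum : Prop4LetterNum b (281600000000000000 * (F.L : ℝ) * N) (1 / (200000000000 * (F.L : ℝ) * N)) aC εC RV R')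
    (hV : Prop4LetterV0AtRecord F N K k Ω U₀ CV RV) (hsym : Prop4LetterSymmPrAtRecord F N K k Ω U₀ Gp)
    (hcol : Prop4LetterColumnsPrAtRecord F N K k Ω U₀ (hierFrameDatumOfRecord F N k U₀) levB a hpos hQ εC Gp R' θ₃ θE θE' N₁) (hJ : ‖JOfRecordAtBg F N K k Ω U₀‖ ≤ nJ) :
    Prop4UniformPrAtRecord F N K k Ω U₀ (hierFrameDatumOfRecord F N k U₀) levB a hpos hQ εC Gp (c4OfRecord N nJ b (281600000000000000 * (F.L : ℝ) * N) εC aC CV R' θ₃ θE θE' N₁) R' :=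
  prop4UniformPrAtRecord_of_letters_of_norm_J_le F N K k Ω U₀ (hierFrameDatumOfRecord F N k U₀) levB a hpos hQ Gp hH
    (prop4LetterCPrAtRecord_hierFrame_of_regular F N k Ω U₀ levB hΩ hα0 hα hreg) hnum hV hsym hcol hJ

end Record

end Summit.QuantumFields.YangMills.Theorems.C44IterMh

end
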